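import Literature.AnabelianGeometry.SemiGraphs.PSCSeparatingCoveringsThreeChainPointed
import Literature.AnabelianGeometry.SemiGraphs.PSCSeparatingCoveringsTwoComponentAffineEdges
import Literature.AnabelianGeometry.SemiGraphs.ProSigmaHeisenbergSeparation
import Literature.AnabelianGeometry.SemiGraphs.PSCTwoComponentUnmarkedEdges
import HarnessLib

/-!
# [CombGC] Prop. 1.2, proof p. 9: EDGE-LIKE separating coverings at THREE-COMPONENT CHAINS pointed on every component (row F-2827)

Mochizuki, *A combinatorial version of the Grothendieck conjecture*, Tohoku Math. J. **59** (2007)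
[CombGC], PROOF of Proposition 1.2, author's manuscript p. 9, the resp'd (edge) case: "there exists a
finite étale … `Π_G`-covering `G' → G` whose restriction to the anabelioid `G_{e₂}` is trivial …, but whose
restriction to the anabelioid `G_{e₁}` is nontrivial" [cite: MochizukiCombGC2007, Prop 1.2 proof p.9]; typed
LEVEL-WISE as `PSCDatum.EdgeLikeSeparatingCoverings` (abc-iut-w4-d081, row P12-L01-E; abc-iut FACT-LIST
row F-2827, the edge conjunct of F-2829 / F-2830 — a schema whose universal closure is refuted as typed;
the instance forms at genuine carriers are the content).

PROOF-ONLY file (abc-iut-f-166 gen 6, row «POINTED-CHAIN», file 2; 0 definitions).  The carrier: abc-iut-f-164's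
three-component chain shape (`C₀ ∪_{ν_A} C_mid ∪_{ν_B} C₁`; node groups `cl ι⟨ε_A⟩`, `cl ι⟨η⟩`; cusp groups the
closed cusp inertia groups; marked points `c_j` on `C₁` for `j < s₁`, on `C_mid` for `s₁ ≤ j < s₂`, on `C₀`
for `s₂ ≤ j`) with the cusp bounds relaxed to `1 ≤ s₁ < s₂ < r` plus the stability of the two end components
— chains with ONE marked point on some component, which abc-iut-f-164's `edgeLikeSeparatingCoverings_of_threeChain`
(`2 ≤ s₁`, `s₁ + 2 ≤ s₂`, `s₂ + 2 ≤ r`, cusp characters `δ_k − δ_m` throughout) leaves out.  Both loops are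
members of the chain basis (`exists_chainBasis`) and every cusp generator of some free basis
(`exists_freeGroupBasis_eq_c`), so gen 3's `edgeLikeSeparatingCoverings_of_rankOneFreeFactors` applies; the
separating homomorphisms take values in `ℤ/3 × H₃` (`H₃` the Heisenberg group mod `3`): cusp characters
`δ_k − δ_m` (values `[s₂ ≤ k] − [s₂ ≤ m]` on `ε_A`, `[s₁ ≤ k] − [s₁ ≤ m]` on `η`) wherever a spare marked point
exists, and — when an END component carries a SINGLE marked point `c_k`, where `ε_A ≡ c_k^{∓1}` (resp.
`η ≡ c_k^{∓1}`) modulo letters every useful abelian character must kill — the NON-ABELIAN handle-cusp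
homomorphisms `(a_{i₀}, b_{i₀}, c_{j₀}) ↦ (X, Y, [X,Y]⁻¹)` (`exists_hom_handle_cusp`, `hom_handle_cusp_nodeLoop`)
at a handle of that end component (of positive genus by stability).  The middle component always offers
`ε_A`, `η` and a marked point, so no certificate is needed from its genus.

* `edgeLikeSeparatingCoverings_of_threeChain'` — **F-2827** (`V' := V`) at EVERY pointed three-chain datum.

Instance forms at data of the shape of genuine stable curves: consistency evidence for the typed schema, not
the printed theorem for all pointed stable curves.  Nothing here takes a side on [IUTchIII] Cor. 3.12.
-/

noncomputable section

namespace Literature.AnabelianGeometry.SemiGraphs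

namespace PSCDatum

open scoped Pointwise
open Multiplicative
open Literature.GroupTheory.CombinatorialGroupTheory
open Literature.GroupTheory.CombinatorialGroupTheory.PuncturedSurfaceGroup (a b c cuspInertia
  exists_chainBasis exists_freeGroupBasis_eq_c exists_handleCuspCharacter
  exists_hom_handle_cusp hom_handle_cusp_nodeLoop)
open SemiGraphOfAnabelioids (IsProSigmaCompletion)
open TwoComponentAffine (character_nodeLoop sum_ite_twoDelta sum_twoDelta)

section ThreeChain

variable {P : Type} [Group P] [TopologicalSpace P] [IsTopologicalGroup P]
variable [CompactSpace P] [TotallyDisconnectedSpace P] {Sigma : Set ℕ} {g r : ℕ}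

/-- `ofAdd 1 ≠ 1` in `ℤ/3`. [cite: MochizukiCombGC2007, Prop 1.2 proof p.9] -/
private theorem ofAdd_one_ne_one₃' : (ofAdd (1 : ZMod 3) : Multiplicative (ZMod 3)) ≠ 1 := by
  intro h
  have h1 : (1 : ZMod 3) = 0 := Multiplicative.ofAdd.injective (h.trans ofAdd_zero.symm)
  exact absurd h1 (by decide)

/-- Three pairwise distinct indices leave, for any two given indices, one different from both.
[cite: MochizukiCombGC2007, Prop 1.2 proof p.9] -/
private theorem exists_ne_ne_of_three {n : ℕ} (x y z k m : Fin n) (hxy : x ≠ y) (hxz : x ≠ z) (hyz : y ≠ z) :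
    ∃ t : Fin n, t ≠ k ∧ t ≠ m := by
  by_cases hx : x ≠ k ∧ x ≠ m
  · exact ⟨x, hx⟩
  · by_cases hy : y ≠ k ∧ y ≠ m
    · exact ⟨y, hy⟩
    · refine ⟨z, fun h => ?_, fun h => ?_⟩ <;> subst h
      · rw [not_and_or, not_not, not_not] at hx hy
        rcases hx with h | h
        · exact hxz h
        · rcases hy with h' | h'
          · exact hyz h'
          · exact hxy (h.trans h'.symm)
      · rw [not_and_or, not_not, not_not] at hx hy
        rcases hx with h | h
        · rcases hy with h' | h'
          · exact hxy (h.trans h'.symm)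
          · exact hyz h'
        · exact hxz h

/-- **Row P12-L01-E / F-2827 (`EdgeLikeSeparatingCoverings`, `V' := V`) at EVERY three-component chain datum
pointed on every component** (`1 ≤ s₁ < s₂ < r`, end components stable, `g₀ ≤ g₁ ≤ g`): node/node, node/cusp,
cusp/node and cusp/cusp pairs of level edges alike. [cite: MochizukiCombGC2007, Prop 1.2 proof p.9] -/
theorem edgeLikeSeparatingCoverings_of_threeChain' (hne : Sigma.Nonempty)
    (hprime : ∀ p ∈ Sigma, p.Prime) (ι : PuncturedSurfaceGroup g r →* P)
    (hι : IsProSigmaCompletion Sigma ι) (G : PSCDatum P) {g₀ g₁ s₁ s₂ : ℕ} (hg : g₀ ≤ g₁) (hg₁ : g₁ ≤ g)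
    (hs₁ : 1 ≤ s₁) (hs₁₂ : s₁ < s₂) (hs₂ : s₂ < r) (hst₀ : 1 ≤ g₀ ∨ 2 ≤ r - s₂) (hst₁ : 1 ≤ g - g₁ ∨ 2 ≤ s₁)
    (e : G.graph.C ≃ Fin r)
    (hC : ∀ c', G.cuspGp c' = ((cuspInertia (g := g) (e c')).map ι).topologicalClosure)
    (εA η : PuncturedSurfaceGroup g r)
    (hεA : εA = ((List.finRange r).map fun j : Fin r =>
          if s₂ ≤ (j : ℕ) then PuncturedSurfaceGroup.c (g := g) j else 1).prod *
        ((List.finRange g).map fun i : Fin g => if (i : ℕ) < g₀ then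
          PuncturedSurfaceGroup.a (r := r) i * PuncturedSurfaceGroup.b i *
            (PuncturedSurfaceGroup.a i)⁻¹ * (PuncturedSurfaceGroup.b i)⁻¹ else 1).prod)
    (hη : η = ((List.finRange r).map fun j : Fin r =>
          if s₁ ≤ (j : ℕ) then PuncturedSurfaceGroup.c (g := g) j else 1).prod *
        ((List.finRange g).map fun i : Fin g => if (i : ℕ) < g₁ then
          PuncturedSurfaceGroup.a (r := r) i * PuncturedSurfaceGroup.b i *
            (PuncturedSurfaceGroup.a i)⁻¹ * (PuncturedSurfaceGroup.b i)⁻¹ else 1).prod)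
    (nA nB : G.graph.N) (hN : ∀ n, n = nA ∨ n = nB)
    (hEA : G.nodeGp nA = ((Subgroup.zpowers εA).map ι).topologicalClosure)
    (hEB : G.nodeGp nB = ((Subgroup.zpowers η).map ι).topologicalClosure) :
    G.EdgeLikeSeparatingCoverings := by
  classical
  obtain ⟨r', rfl⟩ : ∃ r', r = r' + 1 := ⟨r - 1, by omega⟩
  have hSig : ∃ ℓ ∈ Sigma, ℓ.Prime := hne.imp fun p hp => ⟨hp, hprime p hp⟩
  -- the chain basis (both loops are members)
  obtain ⟨B, -, -, -, hA, hBη⟩ := exists_chainBasis εA η hεA hη hs₁ hs₁₂ (by omega)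
  -- the generators of the edge groups (`nA ≠ nB` is not needed: the other node is `nB` by `hN`)
  let xs : G.graph.N ⊕ G.graph.C → PuncturedSurfaceGroup g (r' + 1) :=
    Sum.elim (fun n => if n = nA then εA else η) fun c' => c (e c')
  have hxA : ∀ n, n = nA → xs (Sum.inl n) = εA := fun n hn => if_pos hn
  have hxB : ∀ n, n ≠ nA → xs (Sum.inl n) = η := fun n hn => if_neg hn
  have hx : ∀ e', G.edgeGp e' = ((Subgroup.zpowers (xs e')).map ι).topologicalClosure := by
    rintro (n | c')
    · change G.nodeGp n = _
      by_cases hn : n = nA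
      · rw [hxA n hn, hn, hEA]
      · rcases hN n with h | h
        · exact absurd h hn
        · rw [hxB n hn, h, hEB]
    · exact hC c'
  have hfac : ∀ e', ∃ (κ : Type) (bκ : FreeGroupBasis κ (PuncturedSurfaceGroup g (r' + 1))) (k : κ),
      bκ k = xs e' := by
    rintro (n | c')
    · by_cases hn : n = nA
      · exact ⟨_, B, _, (hA (by omega)).trans (hxA n hn).symm⟩
      · exact ⟨_, B, _, (hBη (by omega)).trans (hxB n hn).symm⟩
    · obtain ⟨β, bs, k, hk⟩ := exists_freeGroupBasis_eq_c (g := g) (by omega : 2 ≤ r' + 1) (e c')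
      exact ⟨β, bs, k, hk⟩
  -- the target `ℤ/3 × H₃`
  obtain ⟨φ, X, Y, Z, hXYZ, -, hZpow, -⟩ := Heisenberg.exists_heisenbergTriple_central 3
  have hZ1 : Z ≠ 1 := fun h => by
    have h3 : 3 ∣ 1 := (hZpow 1).mp (by rw [pow_one, h])
    omega
  have hW : X * Y * X⁻¹ * Y⁻¹ * Z⁻¹ = 1 := by rw [hXYZ, mul_inv_cancel]
  have hinl : ∀ (χ : PuncturedSurfaceGroup g (r' + 1) →* Multiplicative (ZMod 3))
      (x : PuncturedSurfaceGroup g (r' + 1)),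
      ((MonoidHom.inl (Multiplicative (ZMod 3))
        (Multiplicative (ZMod 3 × ZMod 3) ⋊[φ] Multiplicative (ZMod 3))).comp χ) x = 1 ↔ χ x = 1 :=
    fun χ x => by simp only [MonoidHom.comp_apply, MonoidHom.inl_apply, Prod.mk_eq_one, and_true]
  have hinr : ∀ (ψ : PuncturedSurfaceGroup g (r' + 1) →*
      Multiplicative (ZMod 3 × ZMod 3) ⋊[φ] Multiplicative (ZMod 3)) (x : PuncturedSurfaceGroup g (r' + 1)),
      ((MonoidHom.inr (Multiplicative (ZMod 3))
        (Multiplicative (ZMod 3 × ZMod 3) ⋊[φ] Multiplicative (ZMod 3))).comp ψ) x = 1 ↔ ψ x = 1 :=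
    fun ψ x => by simp only [MonoidHom.comp_apply, MonoidHom.inr_apply, Prod.mk_eq_one, true_and]
  -- the abelian certificates `δ_k − δ_m`, with their values on BOTH loops
  have habel : ∀ k m : Fin (r' + 1), k ≠ m →
      ∃ χ : PuncturedSurfaceGroup g (r' + 1) →* Multiplicative (ZMod 3),
        χ (c k) ≠ 1 ∧ (∀ j, j ≠ k → j ≠ m → χ (c j) = 1) ∧
          χ εA = ofAdd ((if s₂ ≤ (k : ℕ) then (1 : ZMod 3) else 0) +
            (if s₂ ≤ (m : ℕ) then (-1 : ZMod 3) else 0)) ∧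
          χ η = ofAdd ((if s₁ ≤ (k : ℕ) then (1 : ZMod 3) else 0) +
            (if s₁ ≤ (m : ℕ) then (-1 : ZMod 3) else 0)) := by
    intro k m hkm
    obtain ⟨χ, -, -, hχc⟩ := exists_handleCuspCharacter (g := g) (r := r' + 1) (n := 3) (fun _ => 0)
      (fun _ => 0) (fun j => (if j = k then (1 : ZMod 3) else 0) + (if j = m then (-1 : ZMod 3) else 0))
      (sum_twoDelta k m)
    refine ⟨χ, ?_, fun j hjk hjm => ?_, ?_, ?_⟩
    · rw [hχc, if_pos rfl, if_neg hkm, add_zero]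
      exact ofAdd_one_ne_one₃'
    · rw [hχc, if_neg hjk, if_neg hjm, add_zero, ofAdd_zero]
    · rw [hεA, character_nodeLoop χ hχc g₀ s₂, sum_ite_twoDelta]
    · rw [hη, character_nodeLoop χ hχc g₁ s₁, sum_ite_twoDelta]
  -- three distinct cusp indices `0 < s₁ < s₂`
  have h3 : ∀ k m : Fin (r' + 1), ∃ t : Fin (r' + 1), t ≠ k ∧ t ≠ m := fun k m =>
    exists_ne_ne_of_three ⟨0, by omega⟩ ⟨s₁, by omega⟩ ⟨s₂, by omega⟩ k m
      (fun h => by have := congrArg Fin.val h; simp only at this; omega)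
      (fun h => by have := congrArg Fin.val h; simp only at this; omega)
      (fun h => by have := congrArg Fin.val h; simp only at this; omega)
  -- "a spare marked point on `C₀` (resp. `C₁`), or the end component has positive genus and `k` is on it"
  have hK₀ : ∀ k : Fin (r' + 1), (∃ j : Fin (r' + 1), s₂ ≤ (j : ℕ) ∧ j ≠ k) ∨ (s₂ ≤ (k : ℕ) ∧ 1 ≤ g₀) := by
    intro k
    by_cases hk : k = ⟨s₂, by omega⟩
    · rcases hst₀ with h | h
      · exact Or.inr ⟨by rw [hk], h⟩
      · exact Or.inl ⟨⟨s₂ + 1, by omega⟩, by simp only; omega, fun h' => by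
          rw [hk] at h'; exact absurd (congrArg Fin.val h') (by simp)⟩
    · exact Or.inl ⟨⟨s₂, by omega⟩, le_rfl, fun h' => hk h'.symm⟩
  have hK₁ : ∀ k : Fin (r' + 1), (∃ j : Fin (r' + 1), (j : ℕ) < s₁ ∧ j ≠ k) ∨ ((k : ℕ) < s₁ ∧ g₁ < g) := by
    intro k
    by_cases hk : k = ⟨0, by omega⟩
    · rcases hst₁ with h | h
      · exact Or.inr ⟨by rw [hk]; simp only; omega, by omega⟩
      · exact Or.inl ⟨⟨1, by omega⟩, by simp only; omega, fun h' => by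
          rw [hk] at h'; exact absurd (congrArg Fin.val h') (by simp)⟩
    · exact Or.inl ⟨⟨0, by omega⟩, by simp only; omega, fun h' => hk h'.symm⟩
  -- an index below `s₂` different from `k` (`0` or `s₁`), and one `≥ s₁` different from `k` (`s₁` or `s₂`)
  have hlow : ∀ k : Fin (r' + 1), ∃ j : Fin (r' + 1), (j : ℕ) < s₂ ∧ j ≠ k := fun k => by
    by_cases hk : (k : ℕ) = 0
    · exact ⟨⟨s₁, by omega⟩, by simp only; omega, fun h => by rw [← h] at hk; simp only at hk; omega⟩
    · exact ⟨⟨0, by omega⟩, by simp only; omega, fun h => by rw [← h] at hk; exact hk rfl⟩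
  have hhigh : ∀ k : Fin (r' + 1), ∃ j : Fin (r' + 1), s₁ ≤ (j : ℕ) ∧ j ≠ k := fun k => by
    by_cases hk : (k : ℕ) = s₁
    · exact ⟨⟨s₂, by omega⟩, by simp only; omega, fun h => by rw [← h] at hk; simp only at hk; omega⟩
    · exact ⟨⟨s₁, by omega⟩, le_rfl, fun h => by rw [← h] at hk; exact hk rfl⟩
  -- the separating homomorphisms
  have hsep : ∀ e₁ e₂, e₁ ≠ e₂ → ∃ χ : PuncturedSurfaceGroup g (r' + 1) →*
      Multiplicative (ZMod 3) × (Multiplicative (ZMod 3 × ZMod 3) ⋊[φ] Multiplicative (ZMod 3)),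
      χ (xs e₂) = 1 ∧ χ (xs e₁) ≠ 1 := by
    rintro (n₁ | c₁) (n₂ | c₂) hne12
    · -- node / other node: `δ_{s₂} − δ_{s₁}` (alive `ε_A`) resp. `δ_{s₁} − δ_0` (alive `η`)
      by_cases h1 : n₁ = nA
      · have h2 : n₂ ≠ nA := fun h => hne12 (by rw [h1, h])
        rw [hxA n₁ h1, hxB n₂ h2]
        obtain ⟨χ, -, -, hχA, hχB⟩ := habel ⟨s₂, by omega⟩ ⟨s₁, by omega⟩
          (fun h => by have := congrArg Fin.val h; simp only at this; omega)
        refine ⟨(MonoidHom.inl _ _).comp χ, (hinl χ _).mpr ?_, fun h => ?_⟩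
        · rw [hχB, if_pos (show s₁ ≤ s₂ by omega), if_pos (le_refl s₁), add_neg_cancel, ofAdd_zero]
        · rw [hinl, hχA, if_pos (le_refl s₂), if_neg (show ¬ s₂ ≤ s₁ by omega), add_zero] at h
          exact ofAdd_one_ne_one₃' h
      · have h2 : n₂ = nA := by
          rcases hN n₂ with h | h
          · exact h
          · rcases hN n₁ with h' | h'
            · exact absurd h' h1
            · exact absurd (congrArg Sum.inl (h'.trans h.symm)) hne12
        rw [hxB n₁ h1, hxA n₂ h2]
        obtain ⟨χ, -, -, hχA, hχB⟩ := habel ⟨s₁, by omega⟩ ⟨0, by omega⟩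
          (fun h => by have := congrArg Fin.val h; simp only at this; omega)
        refine ⟨(MonoidHom.inl _ _).comp χ, (hinl χ _).mpr ?_, fun h => ?_⟩
        · rw [hχA, if_neg (show ¬ s₂ ≤ s₁ by omega), if_neg (show ¬ s₂ ≤ 0 by omega), add_zero, ofAdd_zero]
        · rw [hinl, hχB, if_pos (le_refl s₁), if_neg (show ¬ s₁ ≤ 0 by omega), add_zero] at h
          exact ofAdd_one_ne_one₃' h
    · -- alive: a node; killed: the cusp `k = e c₂`
      change ∃ χ : _ →* _, χ (c (e c₂)) = 1 ∧ χ (xs (Sum.inl n₁)) ≠ 1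
      by_cases h1 : n₁ = nA
      · rw [hxA n₁ h1]
        rcases hK₀ (e c₂) with ⟨j₁, hj₁, hj₁k⟩ | ⟨hk, hg₀⟩
        · -- a spare marked point `j₁` on `C₀` and `j₂ < s₂`, both `≠ k`: `δ_{j₁} − δ_{j₂}`
          obtain ⟨j₂, hj₂, hj₂k⟩ := hlow (e c₂)
          obtain ⟨χ, -, hχ0, hχA, -⟩ := habel j₁ j₂ (fun h => by rw [h] at hj₁; omega)
          refine ⟨(MonoidHom.inl _ _).comp χ, (hinl χ _).mpr (hχ0 _ hj₁k.symm hj₂k.symm), fun h => ?_⟩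
          rw [hinl, hχA, if_pos hj₁, if_neg (by omega), add_zero] at h
          exact ofAdd_one_ne_one₃' h
        · -- `k` is the only marked point of `C₀` (positive genus): handle `0`, cusp `s₁` on `C_mid`
          obtain ⟨ψ, ha, hb, hc, hab, hc'⟩ :=
            exists_hom_handle_cusp (g := g) (r := r' + 1) ⟨0, by omega⟩ ⟨s₁, by omega⟩ X Y Z⁻¹ hW
          refine ⟨(MonoidHom.inr _ _).comp ψ, (hinr ψ _).mpr (hc' (e c₂) fun h' => ?_), fun h => ?_⟩
          · rw [h'] at hk; simp only at hk; omega
          · rw [hinr, hεA, hom_handle_cusp_nodeLoop ψ ha hb hc hab hc' g₀ s₂,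
              if_neg (show ¬ s₂ ≤ ((⟨s₁, _⟩ : Fin (r' + 1)) : ℕ) by simp only; omega),
              if_pos (show ((⟨0, _⟩ : Fin g) : ℕ) < g₀ by simp only; omega), one_mul, hXYZ] at h
            exact hZ1 h
      · rw [hxB n₁ h1]
        rcases hK₁ (e c₂) with ⟨j₂, hj₂, hj₂k⟩ | ⟨hk, hg₁g⟩
        · -- a spare marked point `j₂` on `C₁` and `j₁ ≥ s₁`, both `≠ k`: `δ_{j₁} − δ_{j₂}`
          obtain ⟨j₁, hj₁, hj₁k⟩ := hhigh (e c₂)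
          obtain ⟨χ, -, hχ0, -, hχB⟩ := habel j₁ j₂ (fun h => by rw [h] at hj₁; omega)
          refine ⟨(MonoidHom.inl _ _).comp χ, (hinl χ _).mpr (hχ0 _ hj₁k.symm hj₂k.symm), fun h => ?_⟩
          rw [hinl, hχB, if_pos hj₁, if_neg (by omega), add_zero] at h
          exact ofAdd_one_ne_one₃' h
        · -- `k` is the only marked point of `C₁` (positive genus): handle `g₁`, cusp `s₁`
          obtain ⟨ψ, ha, hb, hc, hab, hc'⟩ :=
            exists_hom_handle_cusp (g := g) (r := r' + 1) ⟨g₁, hg₁g⟩ ⟨s₁, by omega⟩ X Y Z⁻¹ hW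
          refine ⟨(MonoidHom.inr _ _).comp ψ, (hinr ψ _).mpr (hc' (e c₂) fun h' => ?_), fun h => ?_⟩
          · rw [h'] at hk; simp only at hk; omega
          · rw [hinr, hη, hom_handle_cusp_nodeLoop ψ ha hb hc hab hc' g₁ s₁,
              if_pos (show s₁ ≤ ((⟨s₁, _⟩ : Fin (r' + 1)) : ℕ) from le_rfl),
              if_neg (show ¬ ((⟨g₁, hg₁g⟩ : Fin g) : ℕ) < g₁ from lt_irrefl _), mul_one] at h
            exact hZ1 (inv_eq_one.mp h)
    · -- alive: the cusp `k = e c₁`; killed: a node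
      change ∃ χ : _ →* _, χ (xs (Sum.inl n₂)) = 1 ∧ χ (c (e c₁)) ≠ 1
      by_cases h2 : n₂ = nA
      · rw [hxA n₂ h2]
        by_cases hk : s₂ ≤ (e c₁ : ℕ)
        · rcases hK₀ (e c₁) with ⟨m, hm, hmk⟩ | ⟨-, hg₀⟩
          · obtain ⟨χ, hχk, -, hχA, -⟩ := habel (e c₁) m hmk.symm
            refine ⟨(MonoidHom.inl _ _).comp χ, (hinl χ _).mpr ?_, fun h => hχk ((hinl χ _).mp h)⟩
            rw [hχA, if_pos hk, if_pos hm, add_neg_cancel, ofAdd_zero]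
          · obtain ⟨ψ, ha, hb, hc, hab, hc'⟩ :=
              exists_hom_handle_cusp (g := g) (r := r' + 1) ⟨0, by omega⟩ (e c₁) X Y Z⁻¹ hW
            refine ⟨(MonoidHom.inr _ _).comp ψ, (hinr ψ _).mpr ?_, fun h => ?_⟩
            · rw [hεA, hom_handle_cusp_nodeLoop ψ ha hb hc hab hc' g₀ s₂, if_pos hk,
                if_pos (show ((⟨0, _⟩ : Fin g) : ℕ) < g₀ by simp only; omega), hXYZ, inv_mul_cancel]
            · have h' := (hinr ψ _).mp h
              rw [hc] at h'
              exact hZ1 (inv_eq_one.mp h')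
        · obtain ⟨m, hm, hmk⟩ := hlow (e c₁)
          obtain ⟨χ, hχk, -, hχA, -⟩ := habel (e c₁) m hmk.symm
          refine ⟨(MonoidHom.inl _ _).comp χ, (hinl χ _).mpr ?_, fun h => hχk ((hinl χ _).mp h)⟩
          rw [hχA, if_neg hk, if_neg (by omega), add_zero, ofAdd_zero]
      · rw [hxB n₂ h2]
        by_cases hk : s₁ ≤ (e c₁ : ℕ)
        · obtain ⟨m, hm, hmk⟩ := hhigh (e c₁)
          obtain ⟨χ, hχk, -, -, hχB⟩ := habel (e c₁) m hmk.symm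
          refine ⟨(MonoidHom.inl _ _).comp χ, (hinl χ _).mpr ?_, fun h => hχk ((hinl χ _).mp h)⟩
          rw [hχB, if_pos hk, if_pos hm, add_neg_cancel, ofAdd_zero]
        · rcases hK₁ (e c₁) with ⟨m, hm, hmk⟩ | ⟨-, hg₁g⟩
          · obtain ⟨χ, hχk, -, -, hχB⟩ := habel (e c₁) m hmk.symm
            refine ⟨(MonoidHom.inl _ _).comp χ, (hinl χ _).mpr ?_, fun h => hχk ((hinl χ _).mp h)⟩
            rw [hχB, if_neg hk, if_neg (by omega), add_zero, ofAdd_zero]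
          · obtain ⟨ψ, ha, hb, hc, hab, hc'⟩ :=
              exists_hom_handle_cusp (g := g) (r := r' + 1) ⟨g₁, hg₁g⟩ (e c₁) X Y Z⁻¹ hW
            refine ⟨(MonoidHom.inr _ _).comp ψ, (hinr ψ _).mpr ?_, fun h => ?_⟩
            · rw [hη, hom_handle_cusp_nodeLoop ψ ha hb hc hab hc' g₁ s₁, if_neg hk,
                if_neg (show ¬ ((⟨g₁, hg₁g⟩ : Fin g) : ℕ) < g₁ from lt_irrefl _), mul_one]
            · have h' := (hinr ψ _).mp h
              rw [hc] at h'
              exact hZ1 (inv_eq_one.mp h')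
    · -- cusp / cusp `k ≠ m`: `δ_k − δ_t` for a third index `t`
      have hkm : e c₁ ≠ e c₂ := fun h => hne12 (by rw [e.injective h])
      change ∃ χ : _ →* _, χ (c (e c₂)) = 1 ∧ χ (c (e c₁)) ≠ 1
      obtain ⟨t, htk, htm⟩ := h3 (e c₁) (e c₂)
      obtain ⟨χ, hχk, hχ0, -, -⟩ := habel (e c₁) t htk.symm
      exact ⟨(MonoidHom.inl _ _).comp χ, (hinl χ _).mpr (hχ0 _ hkm.symm htm.symm),
        fun h => hχk ((hinl χ _).mp h)⟩
  exact G.edgeLikeSeparatingCoverings_of_rankOneFreeFactors hι hSig xs hx hfac hsep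

end ThreeChain

end PSCDatum

end Literature.AnabelianGeometry.SemiGraphs

end
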